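import Mathlib
import HarnessLib

/-!
# Möbius twisted by Dirichlet characters to `2`-power moduli (Green 2012, Theorem 3)

Topic `Literature/NumberTheory/LFunctions`. ONE NAMED FACT (no proof in the tree): the classical
estimate that B. Green, *On (not) computing the Möbius function using bounded depth circuits*,
Combin. Probab. Comput. 21 (2012) 942–951 (= arXiv:1103.4991; numbering of the arXiv version)
records in his §4 as the major-arc input of his Fourier–Walsh bound for `μ`:

* Theorem 3 (Green quotes it from Montgomery–Vaughan, *Multiplicative Number Theory I*,
  Exercise 11.3.7 with Theorem 11.4 / (11.7), and adds that no Dirichlet character of conductor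
  `2^e` has an exceptional zero, there being only the three primitive real characters `χ₄`, `χ₈`,
  `χ₄χ₈`): for some absolute `c₂ > 0`, if `χ` is a Dirichlet character to modulus `q = 2^t`,
  `q ≤ e^{c₂ √log N}`, then `E_{0 ≤ x ≤ N−1} μ(x) χ(x) = O(e^{−c₂ √log N})` —
  `green_moebius_character_twoPower`.

Purpose: this is the "Type I / major arc" input — the prime number theorem for `μ` twisted by
characters to moduli `2^t` as large as `e^{c√log N}`, i.e. BEYOND the Siegel–Walfisz range
`q ≤ (log N)^A` of the tree's PROVED `Literature.NumberTheory.LFunctions.SiegelWalfiszMoebius` /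
`MoebiusCharacterSumBound` (possible exactly because `2`-power conductors carry no exceptional
zero) — that a prover EARNING
`Summit.QuantumAdvantage.QuantumAdvantage.Theses.MobiusLadder.WalshLiouvilleBound` (small Walsh
sets, Green's range `|S| < n^{1/2}`, via Green's Propositions 2–3) or
`Summit.PneNP.PneNP.Theses.Mobius.LiouvilleDigitalPhases` needs and which both routes name
explicitly ("L(s, χ mod 2^t) zero-free region incl. no exceptional zero for conductor 2^e";
"Green's 2-power-modulus PNT (q = 2^t ≤ e^{c√log N}, Montgomery–Vaughan Ex. 11.3.7) … tree has
Siegel–Walfisz only for q ≤ (log x)^A").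

Deliberately NOT vendored here: Green's Corollary 1 (`E_{0≤x≤N−1} μ(x) e(ax/2^t) =
O(e^{−c₃√log N})` uniformly for `2^t ≤ e^{c₃√log N}`, `a ∈ ℤ`, `c₃ = c₂/2`), which the paper
DERIVES from Theorem 3 in ten lines (characters of `(ℤ/2^tℤ)^*`, the split `2 ∤ x` / `2 ∥ x` /
`4 ∣ x` and `μ(2x) = −μ(x)` for odd `x`) — a corollary is proved next to the fact by its consumer,
not minted as debt; the Liouville analogue (from `λ = μ ∗ 1_{□}`), likewise not separately
printed. Green's Theorem 1 / Proposition 1 and Bourgain's Möbius–Walsh Theorem 1 (with their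
printed Liouville remarks) are already in the tree as
`Literature/NumberTheory/LFunctions/MoebiusWalshCircuits.lean` (`green_moebius_ACd`,
`green_liouville_ACd`, `green_moebius_fourierWalsh`, `green_liouville_fourierWalsh`,
`bourgain_moebius_walsh_uniform`, `bourgain_liouville_walsh_uniform`) and are not restated.

## Conventions (faithfulness notes)

* Green sums over `0 ≤ x ≤ N − 1` with `μ(0) := 0`; Mathlib's `ArithmeticFunction.moebius 0 = 0`,
  so `Finset.range N` is the printed range and `E` is `(1/N) ∑`; we clear the denominator
  (`‖∑‖ ≤ K · N · e^{−c₂√log N}`), which also covers `N = 0` trivially.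
* `O(·)` with an absolute implied constant is rendered as `∃ K, …`; "for some absolute constant
  `c₂ > 0`" as `∃ c₂ > 0`; `χ` is a Mathlib `DirichletCharacter ℂ (2 ^ t)` evaluated at the
  residue class of `x` (value `0` off the units, as for the paper's Dirichlet characters).
* `Real.log N` for `N : ℕ` is the natural logarithm; `Real.log 0 = Real.log 1 = 0` is harmless
  (then `2^t ≤ e^0` forces `t = 0`, `χ` is the trivial character mod `1`, and the claim reads
  `‖∑_{x<N} μ(x)‖ ≤ K N`, true for `K ≥ 1`) — no vacuity and no junk strengthening.
* Same vocabulary as the tree's `MoebiusCharacterSumBound` (`‖∑ (μ n : ℂ) * χ (n : ZMod q)‖`),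
  except for Green's range of summation `0 ≤ x < N` in place of `1 ≤ n ≤ ⌊x⌋`.

## Mathlib / tree search

Mathlib has `DirichletCharacter`, `ArithmeticFunction.moebius`, `L(1, χ) ≠ 0` and the Dirichlet
PNT groundwork but no zero-free-region estimate for `∑ μ(x)χ(x)`; the tree has
`abs_sum_moebius_le_mul_exp_neg_sqrt_log` (`q = 1`), `MoebiusCharacterSumBound` and
`SiegelWalfiszMoebius` (`q ≤ (log x)^A`, proved), nothing for moduli `2^t ≤ e^{c√log N}`
(`lean search 'SiegelWalfiszMoebius|exceptional zero|2 \^ t'`).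
-/

noncomputable section

open Finset ArithmeticFunction

namespace Literature.NumberTheory.LFunctions

/-- **Möbius twisted by characters to `2`-power moduli** (Green 2012, Theorem 3, as printed; Green
quotes it from Montgomery–Vaughan, *Multiplicative Number Theory I*, Exercise 11.3.7 with
Theorem 11.4, adding that characters of conductor `2^e` have no exceptional zero). "For some
absolute constant `c₂ > 0` the following is true. Suppose that `χ` is a Dirichlet character to
modulus `q = 2^t`, `q ≤ e^{c₂ √log N}`. Then `E_{0 ≤ x ≤ N−1} μ(x) χ(x) = O(e^{−c₂ √log N})`."
Rendered with an explicit absolute implied constant `K` and the denominator `N` cleared. Serves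
(as the major-arc / Type I input for EARNING them)
`Summit.QuantumAdvantage.QuantumAdvantage.Theses.MobiusLadder.WalshLiouvilleBound` and
`Summit.PneNP.PneNP.Theses.Mobius.LiouvilleDigitalPhases`; Green's Corollary 1 (additive
frequencies `a/2^t`) is derived from it by the consumer. [cite: Green2012, Thm 3] -/
def green_moebius_character_twoPower : Prop :=
  ∃ c₂ : ℝ, 0 < c₂ ∧ ∃ K : ℝ, ∀ t N : ℕ, ∀ χ : DirichletCharacter ℂ (2 ^ t),
    ((2 : ℝ) ^ t ≤ Real.exp (c₂ * Real.sqrt (Real.log N))) →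
      ‖∑ x ∈ range N, ((moebius x : ℤ) : ℂ) * χ (x : ZMod (2 ^ t))‖
        ≤ K * (N : ℝ) * Real.exp (-(c₂ * Real.sqrt (Real.log N)))

end Literature.NumberTheory.LFunctions
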